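import Literature.AnabelianGeometry.EtaleTheta.ThetaSubquotientOfTemperedAutImage
import Literature.AnabelianGeometry.EtaleTheta.Discharge.Sec5ThetaSubquotientLevelNOfConnectedTemperoid

/-!
# [EtTh] Prop. 5.5 at the genuine §5 data over `B^temp(Π^tp_X)⁰`, print's image carrier at level `N`: the coefficient map `e` and the binders `he`, `hPproj` DISCHARGED

Mochizuki, *The étale theta function and its Frobenioid-theoretic manifestations*, Publ. RIMS **45** (2009), §5 p. 327 (PDF p. 101)
("`(l·Δ_Θ)_D ⊆ Aut^Θ_D(D)`"), §2 p. 46 ("`(l·Δ_Θ) ↠ (l·Δ_Θ) ⊗ ℤ/Nℤ ≅ μ_N`"), proof of Prop. 5.5 pp. 327–328 (PDF pp. 101–102).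
[cite: MochizukiEtTh2009, Prop 5.5 p.327–328 (PDF pp.101–102)]

PROOF-ONLY (no definitions).  abc-iut cell, seat abc-iut-w5-d020 (gen 4), sequel of `ThetaSubquotientOfTemperedAutImage.lean` (p432202/p432931,
L2-lead R181) and of abc-iut-w4-d042's level-`N` laws (`Discharge/Sec5ThetaSubquotientLevelNOfConnectedTemperoid.lean`, p431034).  For the genuine
§5 data `𝔉 := ofConnectedTemperoidData h Q odd_l R ιX K' …` over `mkOfConnectedTemperoid` with the carrier `Q := autImageStub (RD.qN ιX) RD.iotaN`
(print's image subquotient at the level-`N` parameters of abc-iut-w4-d042's `ThetaSubquotientLevelN.lean`, `Λ := μ_N`) and the term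
`P := thetaSubquotientProjOfConnectedTemperoidDataAutImage …` (a `ThetaSubquotientProj 𝔉`, onto at every object), the binders `e`, `he`, `hPproj` of
abc-iut-L2-t4's `cyclotomicRigidity_ofConnectedTemperoidData_of_pullRoot` (p430047) / `exists_rigidityFamily_unique_preserved_ofConnectedTemperoidData`
(p430304) are DISCHARGED in ∃-packaged form (no definition filed):

* `proj_rho_eq_of_thetaMod_eq` — `P.proj (ρ k)` depends only on `thetaMod k ∈ μ_N` (both sides evaluate at the base point
  `x = (s^⊓_N)^bs(x_{A_N})` to the class of `(thetaMod k)⁻¹`, abc-iut-w4-d042's `evalAt_autProj_rho_eq_thetaMod_inv`, and `evalAt` is injective);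
* `exists_coeffMap_autImage_levelN` — **there is `e : μ_N → (l·Δ_Θ)_{B_N} ⊗ ℤ/Nℤ`, SURJECTIVE, with
  `mk (P.proj (ρ k)) = e (thetaMod k)` for every `k ∈ Π^tp_Ÿ ∩ (l·Δ_Θ)`** — i.e. `(e, he, hPproj)` of p430047 at these `(Q, P)`: `e m` is the
  class of `P.proj (ρ k_m)` for any `k_m ∈ (l·Δ_Θ)` with `thetaMod k_m = m` (`thetaMod_surjective`); surjectivity because every point of print's
  image carrier at `B_N^bs` is `P.proj τ` (`autImageProj_surjective`) and every `τ ∈ P_{B_N^bs}` is a `ρ k`, `k ∈ (l·Δ_Θ)`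
  (abc-iut-w4-d042's `exists_mem_lDeltaTheta_mapAut_rho_eq_of_mem_autPre`).

Universe specialisation as in abc-iut-w4-d042's files (`V : FrdIMonoidStub.{max u₀ w}`, `RD : RigidData.{max u₀ w}`); the instance binder
`[RD.iotaN.range.Normal]` is `RigidData.iotaN_range_normal`.  Nothing of [EtTh]'s curves is asserted; typed ≠ proved for the remaining named binders
of the chain (`hη₀ hdies ν hKν hconst hreach hLc hKR`; `hLc` in ∀-form is NOT expected for the image carrier — DUAL CLAUSE note in the parent file);
no side taken on [IUTchIII] Cor. 3.12.
-/

noncomputable section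

namespace Literature.AnabelianGeometry.EtaleTheta

namespace ThetaFrobenioid

open CategoryTheory Opposite FrobenioidCyclotomicRigidity Literature.AlgebraicGeometry.Frobenioids
  Literature.AnabelianGeometry.SemiGraphs Literature.AnabelianGeometry.SemiGraphs.GaloisObjects

universe u₀ v₀ w

variable {K : Type u₀} [Field K] {X : SemiGraphs.TemperedArithmeticGroup.{u₀} K} {D₀ : Type u₀} [Category.{v₀} D₀]
  {V : FrdIMonoidStub.{max u₀ w}} {T₀ : RealifiedDivisorMonoids (D₀ := D₀) V}
  {VD : FrdICatStub.{u₀ + 1, u₀, max u₀ w} (ConnectedPart (BTemp X.Pi))}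
  {tf : TemperedFrobenioid T₀ (ConnectedPart (BTemp X.Pi)) VD} {hZ : tf.monoidType = MonoidType.Z}
  {hP : ∀ A : (ConnectedPart (BTemp X.Pi))ᵒᵖ, IsPerfect (tf.Φ.carrier A)}
  {NH : Subgroup (Field.absoluteGaloisGroup K) → tf.category → ℕ+ → Prop} {A₀ : tf.category}
  {hA₀ : PreFrobenioid.IsFrobeniusTrivial tf.toElem A₀} {hA₀' : SemiGraphs.IsGaloisObj A₀.base.obj}
  {pullFrac : ∀ {A A' : (BiKummerSetting.mkOfConnectedTemperoid X tf hZ hP NH A₀ hA₀ hA₀').C} (_ : A' ⟶ A),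
    (BiKummerSetting.mkOfConnectedTemperoid X tf hZ hP NH A₀ hA₀ hA₀').biratUnits A →
      (BiKummerSetting.mkOfConnectedTemperoid X tf hZ hP NH A₀ hA₀ hA₀').biratUnits A'}
  {lv : ℕ+}
  {θ : (BiKummerSetting.mkOfConnectedTemperoid X tf hZ hP NH A₀ hA₀ hA₀').biratUnits
    (BiKummerSetting.mkOfConnectedTemperoid X tf hZ hP NH A₀ hA₀ hA₀').Aodot}
  {Bl : (BiKummerSetting.mkOfConnectedTemperoid X tf hZ hP NH A₀ hA₀ hA₀').C}
  {Pl : (BiKummerSetting.mkOfConnectedTemperoid X tf hZ hP NH A₀ hA₀ hA₀').FractionPair θ Bl}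
  {Rl : (BiKummerSetting.mkOfConnectedTemperoid X tf hZ hP NH A₀ hA₀ hA₀').NthRoot θ Pl lv pullFrac}
  {N : ℕ+} {l' : ℕ} {RD : RigidData.{max u₀ w} N l'}
  (h : ModelFrobenioid.Hypotheses tf.divisorMonoid tf.ratFnFunctor) (odd_l : Odd (lv : ℕ))
  (R : (BiKummerSetting.mkOfConnectedTemperoid X tf hZ hP NH A₀ hA₀ hA₀').NthRoot Rl.root Rl.pair N pullFrac)
  (ιX : RD.PiX ≃ₜ* X.Pi) [RD.iotaN.range.Normal] (K' : Type (max u₀ w)) [Field K'] (constEmb : K'ˣ →* tf.biratUnitsModel R.BN)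
  (constEmb_injective : Function.Injective constEmb)
  (hinvc : ∀ g : Aut R.AN.base,
    pull tf.divisorMonoid g.hom (ModelFrobenioid.div R.pair.num) = ModelFrobenioid.div R.pair.num)
  (hinvp : ∀ y : RD.PiX, y ∈ RD.PiYdd →
    pull tf.divisorMonoid ((BiKummerSetting.mkOfConnectedTemperoid X tf hZ hP NH A₀ hA₀ hA₀').galoisSurj R.AN.base
      R.αData.isGalois (ιX y)).hom (ModelFrobenioid.div R.pair.den) = ModelFrobenioid.div R.pair.den)

/-- Membership `ρ k ∈ P_{B_N^bs}` read in `B^temp(Π^tp_X)⁰` (`autImagePre`) for `k ∈ (l·Δ_Θ)` (abc-iut-w4-d042's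
`mapAut_rho_mem_autPre_of_mem_lDeltaTheta` through `mem_autImagePre_iff_mapAut`).  [cite: MochizukiEtTh2009, §5 p.327 (PDF p.101)] -/
theorem rho_mem_autImagePre_of_mem_lDeltaTheta (k : RD.PiX) (hk : k ∈ RD.lDeltaTheta) :
    rhoOfBiKummerData R ιX k ∈ ThetaSubquotient.autImagePre (RD.qN ιX) RD.iotaN R.BN.base :=
  (ThetaSubquotient.mem_autImagePre_iff_mapAut (RD.qN ιX) RD.iotaN R.BN.base _).2
    (mapAut_rho_mem_autPre_of_mem_lDeltaTheta R ιX k hk)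

/-- **`autImageProj (ρ k)` depends only on `thetaMod k ∈ μ_N`** (`k ∈ (l·Δ_Θ)`): both values evaluate at the base point
`x = (s^⊓_N)^bs(x_{A_N})` to the class of `(thetaMod k)⁻¹` (abc-iut-w4-d042's `evalAt_autProj_rho_eq_thetaMod_inv`) and `evalAt` is injective.
[cite: MochizukiEtTh2009, §5 p.327 (PDF p.101); §2 p.46] -/
theorem autImageProj_rho_eq_of_thetaMod_eq (k₁ k₂ : RD.PiX) (hk₁ : k₁ ∈ RD.lDeltaTheta) (hk₂ : k₂ ∈ RD.lDeltaTheta)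
    (hm₁ : rhoOfBiKummerData R ιX k₁ ∈ ThetaSubquotient.autImagePre (RD.qN ιX) RD.iotaN R.BN.base)
    (hm₂ : rhoOfBiKummerData R ιX k₂ ∈ ThetaSubquotient.autImagePre (RD.qN ιX) RD.iotaN R.BN.base)
    (hθ : RD.thetaMod ⟨k₁, hk₁⟩ = RD.thetaMod ⟨k₂, hk₂⟩) :
    ThetaSubquotient.autImageProj (RD.qN ιX) RD.iotaN R.BN.base ⟨_, hm₁⟩ =
      ThetaSubquotient.autImageProj (RD.qN ιX) RD.iotaN R.BN.base ⟨_, hm₂⟩ := by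
  apply Subtype.ext
  rw [ThetaSubquotient.coe_autImageProj, ThetaSubquotient.coe_autImageProj]
  apply ThetaSubquotient.evalAt_injective (RD.qN ιX) RD.iotaN R.BN.base.property
    ((BiKummerSetting.NthRoot.baseIso _ R).hom.hom.hom.hom (galoisBase X.isTempered R.AN.base.obj R.αData.isGalois))
  have e₁ := evalAt_autProj_rho_eq_thetaMod_inv R ιX k₁ hk₁ hm₁
  have e₂ := evalAt_autProj_rho_eq_thetaMod_inv R ιX k₂ hk₂ hm₂
  rw [hθ] at e₁
  exact e₁.trans e₂.symm

set_option maxHeartbeats 400000 in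
/-- Every point of print's image carrier at `B_N^bs` is `autImageProj (ρ k)` for some `k ∈ (l·Δ_Θ)` (onto-ness of `autImageProj`,
p432202, and abc-iut-w4-d042's hgeom `exists_mem_lDeltaTheta_mapAut_rho_eq_of_mem_autPre`).  [cite: MochizukiEtTh2009, §5 p.327 (PDF p.101)] -/
theorem exists_mem_lDeltaTheta_autImageProj_rho_eq (y : ThetaSubquotient.autImage (RD.qN ιX) RD.iotaN R.BN.base.obj) :
    ∃ (k : RD.PiX) (hk : k ∈ RD.lDeltaTheta),
      ThetaSubquotient.autImageProj (RD.qN ιX) RD.iotaN R.BN.base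
          ⟨_, rho_mem_autImagePre_of_mem_lDeltaTheta.{u₀, v₀, w} R ιX k hk⟩ = y := by
  obtain ⟨τ, hτ⟩ := ThetaSubquotient.autImageProj_surjective (RD.qN ιX) RD.iotaN R.BN.base y
  obtain ⟨k, hk, hkτ⟩ := exists_mem_lDeltaTheta_mapAut_rho_eq_of_mem_autPre R ιX
    ((ThetaSubquotient.mem_autImagePre_iff_mapAut (RD.qN ιX) RD.iotaN R.BN.base τ.1).1 τ.2)
  have hρ : rhoOfBiKummerData R ιX k = (τ : Aut R.BN.base) :=
    Iso.ext (ObjectProperty.hom_ext _ (congrArg Iso.hom hkτ))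
  refine ⟨k, hk, ?_⟩
  rw [← hτ]
  congr 1
  exact Subtype.ext hρ

/-- **The coefficient map at `B_N^bs` for print's image carrier, READ IN `B^temp(Π^tp_X)⁰`** (the cheap spelling; the `P`-term's
`pre`/`proj` ARE `autImagePre`/`autImageProj`, `rfl`): there is a SURJECTIVE `e : μ_N → Im(P_{B_N^bs}) ⊗ ℤ/Nℤ` with
`mk (autImageProj (ρ k)) = e (thetaMod k)` for all `k ∈ (l·Δ_Θ)`.  [cite: MochizukiEtTh2009, §5 p.327 (PDF p.101); §2 p.46] -/
theorem exists_coeffMap_autImageProj_levelN :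
    ∃ e : RD.mu → (ThetaSubquotient.autImage (RD.qN ιX) RD.iotaN R.BN.base.obj ⧸
        (powMonoidHom (N : ℕ) : ThetaSubquotient.autImage (RD.qN ιX) RD.iotaN R.BN.base.obj →*
          ThetaSubquotient.autImage (RD.qN ιX) RD.iotaN R.BN.base.obj).range),
      Function.Surjective e ∧
        ∀ (k : RD.PiX) (hk : k ∈ RD.lDeltaTheta)
          (hm : rhoOfBiKummerData R ιX k ∈ ThetaSubquotient.autImagePre (RD.qN ιX) RD.iotaN R.BN.base),
          QuotientGroup.mk (ThetaSubquotient.autImageProj (RD.qN ιX) RD.iotaN R.BN.base ⟨rhoOfBiKummerData R ιX k, hm⟩) =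
            e (RD.thetaMod ⟨k, hk⟩) := by
  choose g hg using RD.thetaMod_surjective
  refine ⟨fun m => QuotientGroup.mk (ThetaSubquotient.autImageProj (RD.qN ιX) RD.iotaN R.BN.base
      ⟨_, rho_mem_autImagePre_of_mem_lDeltaTheta.{u₀, v₀, w} R ιX (g m) (g m).2⟩), ?_, ?_⟩
  · rintro ⟨y⟩
    have H := exists_mem_lDeltaTheta_autImageProj_rho_eq.{u₀, v₀, w} R ιX y
    obtain ⟨k, hk, hky⟩ := H
    refine ⟨RD.thetaMod ⟨k, hk⟩, ?_⟩
    exact (congrArg QuotientGroup.mk (autImageProj_rho_eq_of_thetaMod_eq.{u₀, v₀, w} R ιX _ k (g (RD.thetaMod ⟨k, hk⟩)).2 hk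
      (rho_mem_autImagePre_of_mem_lDeltaTheta.{u₀, v₀, w} R ιX _ (g (RD.thetaMod ⟨k, hk⟩)).2)
      (rho_mem_autImagePre_of_mem_lDeltaTheta.{u₀, v₀, w} R ιX k hk) (hg (RD.thetaMod ⟨k, hk⟩)))).trans
      (congrArg QuotientGroup.mk hky)
  · intro k hk hm
    exact congrArg QuotientGroup.mk (autImageProj_rho_eq_of_thetaMod_eq.{u₀, v₀, w} R ιX k _ hk (g (RD.thetaMod ⟨k, hk⟩)).2 hm
      (rho_mem_autImagePre_of_mem_lDeltaTheta.{u₀, v₀, w} R ιX _ (g (RD.thetaMod ⟨k, hk⟩)).2) (hg (RD.thetaMod ⟨k, hk⟩)).symm)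

/-- **The binders `(e, he, hPproj)` of Prop. 5.5 DISCHARGED for print's image carrier at level `N`, in the binder types of
abc-iut-L2-t4's `cyclotomicRigidity_ofConnectedTemperoidData_of_pullRoot` (p430047)** at `Q := autImageStub (RD.qN ιX) RD.iotaN`,
`P := thetaSubquotientProjOfConnectedTemperoidDataAutImage …`: there is a SURJECTIVE `e : μ_N → (l·Δ_Θ)_{B_N} ⊗ ℤ/Nℤ` with
`mk (P.proj (ρ k)) = e (thetaMod k)` for every `k ∈ Π^tp_Ÿ ∩ (l·Δ_Θ)` — "`(l·Δ_Θ) ↠ (l·Δ_Θ) ⊗ ℤ/Nℤ ≅ μ_N`" (p.46) read on print's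
`Aut`-subquotient.  (The previous theorem transported along the definitional identities `𝔉.BN = B_N`, `𝔉.lDelta = autImage`,
`P.pre = autImagePre`, `P.proj = autImageProj`.)  [cite: MochizukiEtTh2009, Prop 5.5 p.327 (PDF p.101); §2 p.46] -/
theorem exists_coeffMap_autImage_levelN :
    ∃ e : RD.mu →
        (ofConnectedTemperoidData h (ThetaSubquotient.autImageStub (RD.qN ιX) RD.iotaN) odd_l R ιX K' constEmb
          constEmb_injective hinvc hinvp).lDeltaModN
          (ofConnectedTemperoidData h (ThetaSubquotient.autImageStub (RD.qN ιX) RD.iotaN) odd_l R ιX K' constEmb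
            constEmb_injective hinvc hinvp).BN,
      Function.Surjective e ∧
        ∀ (k : RD.PiYdd) (hk : (k : RD.PiX) ∈ RD.lDeltaTheta)
          (hm : rhoOfBiKummerData R ιX k ∈
            (thetaSubquotientProjOfConnectedTemperoidDataAutImage h (RD.qN ιX) RD.iotaN odd_l R ιX K' constEmb
              constEmb_injective hinvc hinvp).pre _),
          (QuotientGroup.mk
              ((thetaSubquotientProjOfConnectedTemperoidDataAutImage h (RD.qN ιX) RD.iotaN odd_l R ιX K' constEmb
                constEmb_injective hinvc hinvp).proj _ ⟨rhoOfBiKummerData R ιX k, hm⟩) :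
              (ofConnectedTemperoidData h (ThetaSubquotient.autImageStub (RD.qN ιX) RD.iotaN) odd_l R ιX K' constEmb
                constEmb_injective hinvc hinvp).lDeltaModN
                (ofConnectedTemperoidData h (ThetaSubquotient.autImageStub (RD.qN ιX) RD.iotaN) odd_l R ιX K' constEmb
                  constEmb_injective hinvc hinvp).BN) =
            e (RD.thetaMod ⟨k, hk⟩) := by
  obtain ⟨e, he, hPe⟩ := exists_coeffMap_autImageProj_levelN.{u₀, v₀, w} (hZ := hZ) (hP := hP) (NH := NH) (hA₀ := hA₀) (hA₀' := hA₀') R ιX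
  exact ⟨e, he, fun k hk hm => hPe k hk hm⟩

end ThetaFrobenioid

end Literature.AnabelianGeometry.EtaleTheta

end
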